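import Summits.AnomalousDissipation.AnomalousDissipation.Theorems.IsotropicCubatureWord
import Summits.AnomalousDissipation.AnomalousDissipation.Theorems.SolenoidalFractalHomogenisationRealisedQuasiStaticCellLawLowerLaw
import Summits.AnomalousDissipation.AnomalousDissipation.Theorems.SolenoidalFractalHomogenisationRealisedQuasiStaticCellLawUpperGlue
import Summits.AnomalousDissipation.AnomalousDissipation.Theorems.SolenoidalFractalHomogenisationRealisedQuasiStaticCellLawUpperSome
import Summits.AnomalousDissipation.AnomalousDissipation.Theorems.SolenoidalFractalHomogenisationLagrangianStepDefs
import HarnessLib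

/-!
# K1L_D `LagrangianRenormalisationStepDesign` (stmt-AnomalousDissipation-27980), skeleton v1′ (`onelevel_design`): the stub `stub_gainPackageW0` BY NAME —
# the realised quasi-static GAIN PACKAGE of the cubature design word `W₀` at gain `c0`

**What is proved.**  `ScalarLawBlock cubatureWord c0` — the REALISED SCALAR LAW BLOCK (second hypothesis of K1L, `…LagrangianStepDefs.ScalarLawBlock`,
p610007) for the isotropic cubature word `Theorems.cubatureWord` (k = 26) with its nominal Taylor constant `Theorems.c0`: for every `δ > 0` a
pre-stretch `M`, a quasi-static threshold `ν₀` and a homogenisation constant `K` with the two-sided bracket — the word gain at rate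
`(1 − δ)(1 − 4·ramp/3)c0` (`WordGainAtRate … ν₀ K 1`) and the single-mode upper law at rate `(1 + δ)(1 − 4·ramp/3)c0`.  This is K2R's conclusion
(`RealisedQuasiStaticCellLaw`, stmt-AnomalousDissipation-20446, CLOSED p608013) with its word witness EXPOSED; the proof is the body of the K2R closer
`RealisedQuasiStaticCellLaw_of` minus its first `refine` (tenure planner ad-ideate-p1 g24, `HOME/ad-ideate-p1/r24/rev18/CubatureSketch.lean`
`cubatureGainPackage_holds`, farm rc 0): lower law `RealisedQuasiStaticCellLaw.lowerLaw` (p600151), upper law `upperLaw_of_upperSome upperSome`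
(p600252 / p605980 …), merged at `M := max M₁ M₂`, `ν₀ := min ν₁ ν₂`, `K := max K₁ K₂` by the monotonicity lemmas `wordGainAtRate_one_mono` /
`upperModeLaw_mono`.  Route-1 rev 18 (RULING R24-1 / D24-3): the crux K1L_D leaves the design word to the skeleton, and skeleton v1′ fixes it to `W₀`
through this S stub.  The theorem carries the registered text `ScalarLawBlock Summit.….Theorems.cubatureWord Summit.….Theorems.c0` verbatim.

No definitions, no named facts, no sorry; rung-leaf bookkeeping only — route-1 closes rung F-D1.A0, a frontier FORMAL rung; nothing about Onsager's
conjecture or anomalous dissipation is claimed.  Prover seat `ad-k3l-bookkeeping-p1` g3, 2026-08-28.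
-/

set_option linter.dupNamespace false

noncomputable section

namespace Summit.AnomalousDissipation.AnomalousDissipation.Theorems.SolenoidalFractalHomogenisation.LagrangianStep

open Literature.Analysis Literature.Analysis.FluidPDE Literature.Analysis.FunctionSpaces
open MeasureTheory Set Filter
open scoped ENNReal NNReal InnerProductSpace

/-- **Registered stub `stub_gainPackageW0` of crux K1L_D `LagrangianRenormalisationStepDesign` (skeleton v1′, line `onelevel_design`), by name and
signature.**  The realised quasi-static gain package of the stretched cubature word at gain `c0`: K2R's two-sided bracket law with the witness
`(26, cubatureWord, c0)` exposed (lower law + upper law from the K2R line files, merged by monotonicity in `ν₀`, `K`).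
[cite: ArmstrongVicol2025, Lemma 3.4 (two-sided control of the renormalized diffusivities)] -/
theorem stub_gainPackageW0 : ScalarLawBlock Summit.AnomalousDissipation.AnomalousDissipation.Theorems.cubatureWord Summit.AnomalousDissipation.AnomalousDissipation.Theorems.c0 := by
  intro δ hδ
  obtain ⟨M₁, hM₁, H₁⟩ := RealisedQuasiStaticCellLaw.lowerLaw δ hδ
  obtain ⟨M₂, hM₂, H₂⟩ := RealisedQuasiStaticCellLaw.upperLaw_of_upperSome RealisedQuasiStaticCellLaw.upperSome δ hδ
  have hM : 0 < max M₁ M₂ := lt_max_of_lt_left hM₁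
  obtain ⟨ν₁, hν₁, K₁, hK₁, L⟩ := H₁ (max M₁ M₂) hM (le_max_left _ _)
  obtain ⟨ν₂, hν₂, K₂, hK₂, U⟩ := H₂ (max M₁ M₂) hM (le_max_right _ _)
  refine ⟨max M₁ M₂, hM, min ν₁ ν₂, lt_min hν₁ hν₂, max K₁ K₂, lt_max_of_lt_left hK₁, ?_, ?_⟩
  · exact RealisedQuasiStaticCellLaw.wordGainAtRate_one_mono _ _ _ _ _ _ (min_le_left _ _) (le_max_left _ _) L
  · exact RealisedQuasiStaticCellLaw.upperModeLaw_mono _ _ _ _ _ _ hK₂ (min_le_right _ _) (le_max_right _ _) U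

end Summit.AnomalousDissipation.AnomalousDissipation.Theorems.SolenoidalFractalHomogenisation.LagrangianStep

end
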